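import Mathlib

/-!
# Skew-cut certificate: the head inverse from injectivity of the head compression (finite-dimensional
truncation)
(instab4 g4 — implementation 2 of the skew-cut X0 certifier, cell `ns-blowup`, 2026-08-26)

HONEST FRAMING (human ruling D-0035): nothing here is a claim about Navier–Stokes blow-up.
WHAT THIS IS NOT: not NS evidence. MODEL lane bookkeeping. The injectivity step
`SkewCutGalerkinInjectivity.injective_of_head_tail_coercive` (and `SkewCutGalerkinTailForm.not_eigenvalue_of_structure`)
asks for the head data of the certificate in operator form: the compression `u ↦ P (R u)` of a bounded
`R` (there `R = R_a = 1 − T − (x₀ − a) S₀`) to the truncation `U` should be injective on `U` (`hAinj`)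
and have a right inverse `Ainv` on `U` with values in `U` (`hAinv`, `hAinvU`). For a FINITE-DIMENSIONAL
`U` (the cube truncation) the second follows from the first (`exists_headInverse`: an injective
endomorphism of a finite-dimensional space is bijective), and the first is the certified
`det A⁽ᴷ⁾(a) ≠ 0` read through the head Gram coordinates (assembly). So the head obligations of (A4) in
HOME/instab4/KERNEL-CHAIN.md reduce to ONE: injectivity of the head compression.

Mathlib only; no new definitions.
-/

noncomputable section

namespace Summit.NavierStokesRegularity.FluidComputer.SkewCutGalerkinHead

open Submodule

variable {𝕜 H : Type*} [RCLike 𝕜] [NormedAddCommGroup H] [InnerProductSpace 𝕜 H]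

/-- **Head inverse from injectivity.** `U` finite-dimensional with star projection `P`; if the head
compression `u ↦ P (R u)` is injective on `U`, then there is a linear `Ainv : H →ₗ H` with
`Ainv (U) ⊆ U` and `P (R (Ainv y)) = y` for `y ∈ U` — the `Ainv`, `hAinvU`, `hAinv` inputs of
`SkewCutGalerkinInjectivity.injective_of_head_tail_coercive`. -/
theorem exists_headInverse (R : H →L[𝕜] H) (U : Submodule 𝕜 H) [FiniteDimensional 𝕜 U]
    [U.HasOrthogonalProjection]
    (hinj : ∀ u ∈ U, U.starProjection (R u) = 0 → u = 0) :
    ∃ Ainv : H →ₗ[𝕜] H, (∀ y ∈ U, Ainv y ∈ U) ∧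
      (∀ y ∈ U, U.starProjection (R (Ainv y)) = y) := by
  -- the head compression as an endomorphism of `U`
  let φ : U →ₗ[𝕜] U :=
    (U.orthogonalProjectionOnto : H →L[𝕜] U).toLinearMap ∘ₗ (R : H →L[𝕜] H).toLinearMap ∘ₗ U.subtype
  have hφ : ∀ u : U, ((φ u : U) : H) = U.starProjection (R (u : H)) := fun u => by
    simp only [φ, LinearMap.coe_comp, Function.comp_apply, Submodule.coe_subtype,
      ContinuousLinearMap.coe_coe, starProjection_apply]
  have hφinj : Function.Injective φ := by
    intro u v huv
    have h : U.starProjection (R ((u : H) - (v : H))) = 0 := by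
      rw [map_sub, map_sub, ← hφ u, ← hφ v, huv, sub_self]
    have := hinj _ (U.sub_mem u.2 v.2) h
    exact Subtype.ext (sub_eq_zero.mp this)
  have hφsurj : Function.Surjective φ := LinearMap.injective_iff_surjective.mp hφinj
  let e : U ≃ₗ[𝕜] U := LinearEquiv.ofBijective φ ⟨hφinj, hφsurj⟩
  -- `Ainv := ι_U ∘ e⁻¹ ∘ (orthogonal projection onto U)`
  refine ⟨U.subtype ∘ₗ (e.symm : U →ₗ[𝕜] U) ∘ₗ
    (U.orthogonalProjectionOnto : H →L[𝕜] U).toLinearMap, fun y _ => ?_, fun y hy => ?_⟩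
  · simp only [LinearMap.coe_comp, Function.comp_apply, Submodule.coe_subtype]
    exact Submodule.coe_mem _
  · simp only [LinearMap.coe_comp, Function.comp_apply, Submodule.coe_subtype,
      ContinuousLinearMap.coe_coe]
    have hPy : U.orthogonalProjectionOnto y = ⟨y, hy⟩ :=
      orthogonalProjectionOnto_mem_subspace_eq_self (⟨y, hy⟩ : U)
    rw [hPy, ← hφ]
    have : φ (e.symm ⟨y, hy⟩) = ⟨y, hy⟩ := by
      change e (e.symm ⟨y, hy⟩) = ⟨y, hy⟩
      exact e.apply_symm_apply _
    exact congrArg Subtype.val this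

/-! ### Injectivity of the head compression from a nonzero determinant (g4 append) -/

open scoped InnerProductSpace in
/-- **Head injectivity from `det ≠ 0`.** For a finite index set `F`, the head compression of `R` to
the truncation `U_F` (closed span of the basis vectors `b_j`, `j ∈ F`) is injective as soon as the
head matrix `(⟪b i, R (b j)⟫)_{i,j ∈ F}` has nonzero determinant — the certified `det A⁽ᴷ⁾(x) ≠ 0`
(for `R = R_x`, this matrix is `A⁽ᴷ⁾(x)·diag(d)` in the class basis; assembly). -/
theorem head_injective_of_det_ne_zero [CompleteSpace H] {ι : Type*} [DecidableEq ι]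
    (b : HilbertBasis ι 𝕜 H) (R : H →L[𝕜] H) (F : Finset ι)
    (hdet : (Matrix.of fun i j : F => ⟪b i, R (b j)⟫_𝕜).det ≠ 0) :
    ∀ u ∈ (span 𝕜 (b '' (F : Set ι))).topologicalClosure,
      (span 𝕜 (b '' (F : Set ι))).topologicalClosure.starProjection (R u) = 0 → u = 0 := by
  set U := (span 𝕜 (b '' (F : Set ι))).topologicalClosure with hU
  haveI : FiniteDimensional 𝕜 (span 𝕜 (b '' (F : Set ι))) :=
    FiniteDimensional.span_of_finite 𝕜 (F.finite_toSet.image _)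
  have hcl : U = span 𝕜 (b '' (F : Set ι)) :=
    (Submodule.closed_of_finiteDimensional _).submodule_topologicalClosure_eq
  intro u hu hPu
  -- coordinates of `u` on `F`
  have hu2 : u ∈ span 𝕜 (b '' (F : Set ι)) := by rw [← hcl]; exact hu
  have hu' : u ∈ span 𝕜 (Set.range fun j : F => b j) := by
    refine (span_le.2 ?_ : span 𝕜 (b '' (F : Set ι)) ≤ span 𝕜 (Set.range fun j : F => b j)) hu2
    rintro _ ⟨i, hi, rfl⟩
    exact subset_span ⟨⟨i, hi⟩, rfl⟩
  obtain ⟨c, hc⟩ := (Submodule.mem_span_range_iff_exists_fun (R := 𝕜)).mp hu'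
  -- `⟪b i, R u⟫ = 0` for `i ∈ F`, and `= (m c)_i`
  have hzero : ∀ i : F, ⟪b (i : ι), R u⟫_𝕜 = 0 := fun i => by
    have hbi : U.starProjection (b i) = b i := starProjection_eq_self_iff.2
      ((span 𝕜 (b '' (F : Set ι))).le_topologicalClosure (subset_span ⟨i, i.2, rfl⟩))
    rw [← hbi, inner_starProjection_left_eq_right, hPu, inner_zero_right]
  have hmul : (Matrix.of fun i j : F => ⟪b i, R (b j)⟫_𝕜).mulVec c = 0 := by
    funext i
    rw [Matrix.mulVec, Pi.zero_apply]
    change ∑ j : F, ⟪b (i : ι), R (b (j : ι))⟫_𝕜 * c j = 0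
    rw [← hzero i, ← hc, map_sum, inner_sum]
    exact Finset.sum_congr rfl fun j _ => by rw [map_smul, inner_smul_right, mul_comm]
  have hc0 : c = 0 := Matrix.eq_zero_of_mulVec_eq_zero hdet hmul
  rw [← hc, hc0]
  simp

end Summit.NavierStokesRegularity.FluidComputer.SkewCutGalerkinHead

end
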